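import Mathlib.Data.Matrix.Basic
import Mathlib.Data.Matrix.Mul
import Mathlib.Data.ZMod.Basic
import Mathlib.Analysis.InnerProductSpace.PiL2
import Mathlib.Analysis.Real.Sqrt
import Literature.Algebra.EuclideanLattices.IntegerBases
import Literature.Algebra.EuclideanLattices.Problems
import Literature.Algebra.EuclideanLattices.Encoding
import Literature.Algebra.EuclideanLattices.LatticeComplexity
import Literature.Computability.Complexity.BoolEncodings
import Literature.Computability.Complexity.GraphEncodings
import Literature.Computability.Complexity.Promise
import Literature.Computability.Complexity.Randomized
import Literature.Computability.Cryptography.OneWayFunctions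
import Literature.Computability.Cryptography.LWENoise
import Literature.Computability.Cryptography.LWEHardness
import HarnessLib

/-!
# The Small Integer Solution problem `SIS` and the Micciancio–Regev worst-case connection

Topic `Computability/Cryptography` (family `pqc`, trunk T-LATTICE), namespaces `Literature.SIS`
(the average-case problem, Ajtai's hash family) and `Literature.PQC` (the hardness facts). First
brick of the decomposition of the named fact `Literature.Computability.Cryptography.owfExist_of_gapSVP_worstCaseHard`
(`Literature/Computability/Cryptography/LatticeOWF.lean`), whose printed proof is:
GapSVP_γ →(MR07 Lemma 5.22) GapCVP′_γ →(MR07 Thm 5.23, PPT, dimension-preserving)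
SIS′_{q,m,β} on the average ←(MR07 §5.1: collisions of `f_A(x) = A x mod q` on `{0,1}^m` are
SIS′ solutions of norm `≤ √m`) inverting Ajtai's function. This file types the average-case
side and vendors Theorem 5.23 as a named fact; the SIS-function-to-OWF step and the assembly
follow in `LatticeOWF.lean`.

## Contents

* `SIS.IsSolution A β z` (MR07 Def. 5.1): `z ∈ ℤ^m ∖ {0}`, `A z = 0 (mod q)`, `‖z‖ ≤ β`;
  `SIS.IsSolution' A β z` (MR07 Def. 5.4, the variant SIS′): additionally / instead `z ∉ 2ℤ^m`
  (some odd coordinate; this implies `z ≠ 0`, `SIS.IsSolution'.isSolution`).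
* `SIS.hashFun A x = A x mod q` (Ajtai's function `f_A`, MR07 §5.1 family `H_{q,m,d}`), the
  domain predicate `SIS.InBox d x` (`x ∈ {0,…,d-1}^m`), and the PROVED collision lemmas
  `SIS.isSolution_sub_of_collision` (a collision `x ≠ y` in `{0,…,d-1}^m` gives the SIS
  solution `x - y` of norm `≤ (d-1)√m`, MR07 §5.1 p. 18) and
  `SIS.isSolution'_sub_of_collision` (for `d = 2` the difference has a `±1` coordinate, so it
  is even an SIS′ solution of norm `≤ √m`).
* `SIS.encodeMatrix A` (self-describing bit string of `A ∈ ℤ_q^{n×m}`, header `n, m, q`),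
  `SIS.matrixAvg` (uniform average over `ℤ_q^{n×m}`, MR07 Def. 5.3), and the average-case
  success probabilities `SIS.successProb B n m q β`, `SIS.successProb' B n m q β` of a
  randomised algorithm `B : RandAlg {0,1}* {0,1}*` (G01) whose output is read with
  `Literature.Lattice.decodeIntVec m`.
* NAMED FACT (D-0014, nothing asserted): `Literature.Computability.Cryptography.MicciancioRegev2007_gapSVP_to_SIS'`
  (MR07 Thm. 5.23 with Lemma 5.22, GapSVP form). The form for SIS and odd moduli ("or SIS when
  the modulus `q` is odd", MR07 p. 28 with Lemma 5.5) is not a separate named fact: it is the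
  conclusion of the PROVED theorems `MicciancioRegev2007_gapSVP_to_SIS_of_SIS'` /
  `MicciancioRegev2007_gapSVP_to_SIS_of_gapCVP'` of `GapSVPToSISOdd.lean` (Lemma 5.5 at machine
  level, `SISOddPart.lean`, `SISOddPartMachine.lean`).

## Faithfulness notes

* MR07 work with full-rank lattices (§2, p. 6) and rational thresholds `d` (Def. 2.2); so do
  `Literature.Lattice.GapSVP.yes/no` (nonsingular integer basis, `d : ℚ`, `0 < d`).
* Theorem 5.23 verbatim (authors' full version, p. 28): "For any polynomially bounded functions
  `β(n), m(n), q(n) = n^{O(1)}`, with `q(n) ≥ 4 √(m(n)) n^{1.5} β(n)`, and `γ(n) = 14π √n β(n)`,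
  there is a probabilistic polynomial time reduction from solving GapCVP′_γ in the worst case
  to solving SIS′_{q,m,β} on the average with non-negligible probability."; p. 27 of the
  authors' version (p. 28 of the SIAM version, right after the theorem's statement): "By
  Lemma 5.22 this also implies a reduction from GapSVP_γ to SIS′ (or SIS when the modulus `q`
  is odd)." The reduction, on an `n`-dimensional instance, queries the oracle on uniformly
  random `A ∈ ℤ_q^{n×m(n)}` of the SAME `n` (proof of Thm. 5.23, p. 28) and Lemma 5.22's Cook
  reduction preserves the dimension; hence the conclusion holds dimension-wise, which is
  recorded here in the "restricted to a set `S` of dimensions" form (the form the OWF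
  application needs: an inverter only succeeds for infinitely many security parameters).
  "Probabilistic polynomial-time reduction R with a PPT oracle B" is unpacked as membership of
  the restricted promise problem in textbook promise-BPP (`CplxCore.PromiseBPP'`, bounded error
  on the promise only), for all dimensions `≥ n₀` in `S` (asymptotic statement; `n₀` may depend
  on everything).
* Uniformity: as for Regev/Peikert/BLPRS in `LWEHardness.lean`, ONE uniform reduction must
  compute `q(n)`, `m(n)` and (a rational handle on) `β(n)` from `1ⁿ`; this implicit hypothesis
  is `Literature.PQC.IsPolyTimeParams q β m` (reused verbatim, `β` in the slot of `α`). Restricting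
  `β` to rational values loses nothing in applications (`β = √m` may be replaced by `β = m`).
* Norms: `‖z‖` is the Euclidean norm of `z ∈ ℤ^m` read in `ℝ^m` through
  `Literature.Algebra.EuclideanLattices.intVecToEuclidean` (as in `SVP.IsSolution`).
* `n^{1.5}` is written `n * √n` (no `rpow`).

## References

* D. Micciancio, O. Regev, *Worst-case to average-case reductions based on Gaussian measures*,
  SIAM J. Comput. 37 (2007) 267–302; authors' full version: Def. 2.2 (p. 6), Def. 5.1, Lemma
  5.2, Def. 5.3, Def. 5.4, Lemma 5.5, §5.1 (Defs. pp. 16–17; family `H_{q,m,d}` and collision remark p. 18), Def. 5.21, Lemma 5.22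
  (p. 27), Thm. 5.23 (p. 28).
* C. Peikert, *A decade of lattice cryptography*, Found. Trends TCS 10 (2016), Def. 4.1.1,
  §4.1.1 (collision bullet), Thm. 4.1.2.
* M. Ajtai, *Generating hard instances of lattice problems*, STOC 1996, Thm. 1.
* O. Goldreich, *Foundations of Cryptography I*, CUP 2001, §1.3 (PPT), Def. 2.2.1.
-/

noncomputable section

open Computability Literature.Computability.Complexity Literature.Algebra.EuclideanLattices Literature.Computability.Cryptography Literature.Computability.Cryptography.LWE

namespace Literature.Computability.Cryptography

namespace SIS

variable {n m q : ℕ}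

/-! ### The problems SIS and SIS′ (MR07 Def. 5.1, Def. 5.4) -/

/-- The residue vector of an integer vector `x ∈ ℤ^m` modulo `q`; literally `Int.cast ∘ x`
(a named wrapper only — `simp [modVec]` exposes it, do not build a separate API).
[Micciancio–Regev 2007, Def. 5.1 (`A z mod q`)] [cite: MicciancioRegev2007, Def. 5.1] -/
def modVec (q : ℕ) (x : Fin m → ℤ) : Fin m → ZMod q := fun j => (x j : ZMod q)

/-- `modVec` is additive: `(x - y) mod q = x mod q - y mod q`. [folklore] -/
@[simp] theorem modVec_sub (q : ℕ) (x y : Fin m → ℤ) :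
    modVec q (x - y) = modVec q x - modVec q y := by
  funext j; simp [modVec]

/-- `SIS.IsSolution A β z` (the Small Integer Solution problem, MR07 Def. 5.1): `z ∈ ℤ^m` is a
solution of the SIS instance `(q, A, β)`, `A ∈ ℤ_q^{n×m}`, iff `z ≠ 0`, `A z = 0 (mod q)` and
`‖z‖ ≤ β` (Euclidean norm). [Micciancio–Regev 2007, Def. 5.1; Peikert 2016, Def. 4.1.1] [cite: MicciancioRegev2007, Def. 5.1] -/
def IsSolution (A : Matrix (Fin n) (Fin m) (ZMod q)) (β : ℝ) (z : Fin m → ℤ) : Prop :=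
  z ≠ 0 ∧ A.mulVec (modVec q z) = 0 ∧ ‖intVecToEuclidean m z‖ ≤ β

/-- `SIS.IsSolution' A β z` (the variant SIS′, MR07 Def. 5.4): `z ∈ ℤ^m ∖ 2ℤ^m` (some
coordinate of `z` is odd), `A z = 0 (mod q)` and `‖z‖ ≤ β`. Any SIS′ solution is an SIS
solution (`IsSolution'.isSolution`); for odd `q` the converse holds up to a polynomial-time
transformation (MR07 Lemma 5.5). [Micciancio–Regev 2007, Def. 5.4] [cite: MicciancioRegev2007, Def. 5.4] -/
def IsSolution' (A : Matrix (Fin n) (Fin m) (ZMod q)) (β : ℝ) (z : Fin m → ℤ) : Prop :=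
  (∃ j, Odd (z j)) ∧ A.mulVec (modVec q z) = 0 ∧ ‖intVecToEuclidean m z‖ ≤ β

/-- An SIS′ solution is an SIS solution (`0 ∈ 2ℤ^m`, MR07 after Def. 5.4). [Micciancio–Regev
2007, §5.1 (remark after Def. 5.4)] [cite: MicciancioRegev2007, Def. 5.4] -/
theorem IsSolution'.isSolution {A : Matrix (Fin n) (Fin m) (ZMod q)} {β : ℝ} {z : Fin m → ℤ}
    (h : IsSolution' A β z) : IsSolution A β z := by
  refine ⟨?_, h.2.1, h.2.2⟩
  rintro rfl
  obtain ⟨j, hj⟩ := h.1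
  simp at hj

/-- SIS is monotone in the norm bound: a solution for `β` is a solution for every `β' ≥ β`.
[Micciancio–Regev 2007, Def. 5.1] [cite: MicciancioRegev2007, Def. 5.1] -/
theorem IsSolution.mono {A : Matrix (Fin n) (Fin m) (ZMod q)} {β β' : ℝ} {z : Fin m → ℤ}
    (h : IsSolution A β z) (hβ : β ≤ β') : IsSolution A β' z :=
  ⟨h.1, h.2.1, h.2.2.trans hβ⟩

/-- SIS′ is monotone in the norm bound. [Micciancio–Regev 2007, Def. 5.4] [cite: MicciancioRegev2007, Def. 5.4] -/
theorem IsSolution'.mono {A : Matrix (Fin n) (Fin m) (ZMod q)} {β β' : ℝ} {z : Fin m → ℤ}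
    (h : IsSolution' A β z) (hβ : β ≤ β') : IsSolution' A β' z :=
  ⟨h.1, h.2.1, h.2.2.trans hβ⟩

/-! ### Ajtai's function `f_A` and collisions (MR07 §5.1) -/

/-- Ajtai's function `f_A(x) = A x mod q ∈ ℤ_qⁿ` on integer vectors `x ∈ ℤ^m` (MR07 §5.1: the
family `H_{q,m,d} = {f_A : {0,…,d-1}^m → ℤ_qⁿ}`; Ajtai 1996 takes `d = 2`). The domain
restriction is the separate predicate `SIS.InBox d`. [Micciancio–Regev 2007, §5.1 (family
`H_{q,m,d}`, p. 18); Peikert 2016, Def. 4.1.1 (4.1.1)] [cite: MicciancioRegev2007, §5.1] -/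
def hashFun (A : Matrix (Fin n) (Fin m) (ZMod q)) (x : Fin m → ℤ) : Fin n → ZMod q :=
  A.mulVec (modVec q x)

/-- `SIS.InBox d x`: `x ∈ {0, …, d-1}^m`, the domain of Ajtai's function `f_A` in the family
`H_{q,m,d}`. [Micciancio–Regev 2007, §5.1 (p. 18)] [cite: MicciancioRegev2007, §5.1] -/
def InBox (d : ℕ) (x : Fin m → ℤ) : Prop :=
  ∀ j, 0 ≤ x j ∧ x j < d

/-- The difference of two vectors of the box `{0,…,d-1}^m` has Euclidean norm at most
`(d - 1) √m` (every coordinate lies in `[-(d-1), d-1]`). [Micciancio–Regev 2007, §5.1 (p. 18: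
"z = x − y … of length at most β(n) = (d(n) − 1)√m(n)")] [cite: MicciancioRegev2007, §5.1] -/
theorem norm_sub_le_of_inBox {d : ℕ} {x y : Fin m → ℤ} (hx : InBox d x) (hy : InBox d y)
    (hd : 1 ≤ d) : ‖intVecToEuclidean m (x - y)‖ ≤ ((d : ℝ) - 1) * Real.sqrt m := by
  rw [Literature.Algebra.EuclideanLattices.norm_intVecToEuclidean m]
  have hd' : (0 : ℝ) ≤ (d : ℝ) - 1 := by
    have : (1 : ℝ) ≤ d := by exact_mod_cast hd
    linarith
  have hcoord : ∀ j, (((x - y) j : ℤ) : ℝ) ^ 2 ≤ ((d : ℝ) - 1) ^ 2 := by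
    intro j
    have hx1 : (0 : ℝ) ≤ x j := by exact_mod_cast (hx j).1
    have hx2 : (x j : ℝ) ≤ d - 1 := by
      have : x j ≤ (d : ℤ) - 1 := by linarith [(hx j).2]
      exact_mod_cast this
    have hy1 : (0 : ℝ) ≤ y j := by exact_mod_cast (hy j).1
    have hy2 : (y j : ℝ) ≤ d - 1 := by
      have : y j ≤ (d : ℤ) - 1 := by linarith [(hy j).2]
      exact_mod_cast this
    have hsub : (((x - y) j : ℤ) : ℝ) = (x j : ℝ) - (y j : ℝ) := by simp
    rw [hsub]
    apply sq_le_sq'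
    · linarith
    · linarith
  have hsum : ∑ j, (((x - y) j : ℤ) : ℝ) ^ 2 ≤ (m : ℝ) * ((d : ℝ) - 1) ^ 2 := by
    calc ∑ j, (((x - y) j : ℤ) : ℝ) ^ 2 ≤ ∑ _j : Fin m, ((d : ℝ) - 1) ^ 2 :=
          Finset.sum_le_sum fun j _ => hcoord j
      _ = (m : ℝ) * ((d : ℝ) - 1) ^ 2 := by simp
  rw [Real.sqrt_le_iff]
  refine ⟨mul_nonneg hd' (Real.sqrt_nonneg _), ?_⟩
  calc ∑ j, (((x - y) j : ℤ) : ℝ) ^ 2 ≤ (m : ℝ) * ((d : ℝ) - 1) ^ 2 := hsum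
    _ = (((d : ℝ) - 1) * Real.sqrt m) ^ 2 := by
        rw [mul_pow, Real.sq_sqrt (Nat.cast_nonneg m)]; ring

/-- **Collisions are SIS solutions** (MR07 §5.1, p. 18; Peikert 2016 §4.1.1): if `x ≠ y` in
`{0,…,d-1}^m` collide under `f_A`, then `z = x - y` is a solution of the SIS instance
`(q, A, (d-1)√m)`. [Micciancio–Regev 2007, §5.1 (p. 18)] [cite: MicciancioRegev2007, §5.1] -/
theorem isSolution_sub_of_collision {d : ℕ} {A : Matrix (Fin n) (Fin m) (ZMod q)}
    {x y : Fin m → ℤ} (hx : InBox d x) (hy : InBox d y) (hne : x ≠ y)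
    (hcoll : hashFun A x = hashFun A y) :
    IsSolution A (((d : ℝ) - 1) * Real.sqrt m) (x - y) := by
  have hd : 1 ≤ d := by
    by_contra hd
    push Not at hd
    apply hne
    funext j
    have := (hx j).2
    have := (hx j).1
    omega
  refine ⟨sub_ne_zero.2 hne, ?_, norm_sub_le_of_inBox hx hy hd⟩
  rw [modVec_sub, Matrix.mulVec_sub]
  exact sub_eq_zero.2 hcoll

/-- **Binary collisions are SIS′ solutions** (MR07 §5.1 with Def. 5.4; the case `d = 2` of
Ajtai 1996): if `x ≠ y ∈ {0,1}^m` collide under `f_A`, then `x - y ∈ {0,±1}^m` has a `±1`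
(odd) coordinate, so it solves the SIS′ instance `(q, A, √m)` — no parity condition on `q` is
needed on this route. [Micciancio–Regev 2007, §5.1 (p. 18) and Def. 5.4 (p. 17)] [cite: MicciancioRegev2007, §5.1] -/
theorem isSolution'_sub_of_collision {A : Matrix (Fin n) (Fin m) (ZMod q)} {x y : Fin m → ℤ}
    (hx : InBox 2 x) (hy : InBox 2 y) (hne : x ≠ y) (hcoll : hashFun A x = hashFun A y) :
    IsSolution' A (Real.sqrt m) (x - y) := by
  have h := isSolution_sub_of_collision hx hy hne hcoll
  have h2 : ((2 : ℕ) : ℝ) - 1 = 1 := by norm_num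
  rw [h2, one_mul] at h
  refine ⟨?_, h.2.1, h.2.2⟩
  obtain ⟨j, hj⟩ : ∃ j, x j ≠ y j := by
    by_contra hall
    push Not at hall
    exact hne (funext hall)
  refine ⟨j, ?_⟩
  have hx1 := (hx j).1; have hx2 := (hx j).2; have hy1 := (hy j).1; have hy2 := (hy j).2
  have : (x - y) j = 1 ∨ (x - y) j = -1 := by
    simp only [Pi.sub_apply]
    omega
  rcases this with h1 | h1 <;> rw [h1] <;> decide

/-! ### SIS instances as bit strings; average-case success (MR07 Def. 5.3) -/

/-- The bit string of an SIS matrix `A ∈ ℤ_q^{n×m}`: the self-describing header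
`boolPair (encodeNat n) (boolPair (encodeNat m) (boolPair (encodeNat q) ·))` followed by the
row-major `encodingFinVec` code of the entries, each residue written in binary through its
representative `ZMod.val ∈ [0, q)` (same conventions as `Literature.Computability.Cryptography.encodeLWESamples`). The norm
bound `β(n)` is not part of the input (the solver knows the parameter functions).
[Micciancio–Regev 2007, Def. 5.3 (instances `(q(n), A, β(n))`); Arora–Barak 2009, §0.1] [cite: MicciancioRegev2007, Def. 5.3] -/
def encodeMatrix (A : Matrix (Fin n) (Fin m) (ZMod q)) : List Bool :=
  boolPair (encodeNat n) (boolPair (encodeNat m) (boolPair (encodeNat q)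
    ((encodingFinVec (encodingFinVec encodingNatBool m) n).encode fun i j => (A i j).val)))

/-- `encodeMatrix` is injective on `ℤ_q^{n×m}` for `q ≠ 0` (residues are determined by their
representatives). [Mathlib `Computability.Encoding.encode_injective`, `ZMod.val_injective`] [folklore] -/
theorem encodeMatrix_injective [NeZero q] :
    Function.Injective (encodeMatrix : Matrix (Fin n) (Fin m) (ZMod q) → List Bool) := by
  intro A B h
  set e := encodingFinVec (encodingFinVec encodingNatBool m) n
  have h1 := (Prod.ext_iff.1 (boolPair_injective (a₁ := (_, _)) (a₂ := (_, _)) h)).2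
  have h2 := (Prod.ext_iff.1 (boolPair_injective (a₁ := (_, _)) (a₂ := (_, _)) h1)).2
  have h3 : e.encode (fun i j => (A i j).val) = e.encode (fun i j => (B i j).val) :=
    (Prod.ext_iff.1 (boolPair_injective (a₁ := (_, _)) (a₂ := (_, _)) h2)).2
  have h4 := e.encode_injective h3
  ext i j
  exact ZMod.val_injective _ (congr_fun (congr_fun h4 i) j)

/-- The uniform average of `g` over all matrices `A ∈ ℤ_q^{n×m}` (`q ≠ 0`):
`(∑_A g A) / q^{n m}`; the expectation under MR07's ensemble `U(ℤ_q^{n×m(n)})`.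
[Micciancio–Regev 2007, Def. 5.3] [cite: MicciancioRegev2007, Def. 5.3] -/
def matrixAvg (n m q : ℕ) [NeZero q] (g : Matrix (Fin n) (Fin m) (ZMod q) → ℝ) : ℝ :=
  (∑ A : Matrix (Fin n) (Fin m) (ZMod q), g A) / (q : ℝ) ^ (n * m)

/-- There are `q^{n m}` matrices in `ℤ_q^{n×m}`. [folklore] -/
theorem card_matrix (n m q : ℕ) [NeZero q] :
    Fintype.card (Matrix (Fin n) (Fin m) (ZMod q)) = q ^ (n * m) := by
  change Fintype.card (Fin n → Fin m → ZMod q) = _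
  rw [Fintype.card_fun, Fintype.card_fun, ZMod.card, Fintype.card_fin, Fintype.card_fin,
    ← pow_mul, mul_comm]

/-- The uniform average of a nonnegative function is nonnegative. [folklore] -/
theorem matrixAvg_nonneg {n m q : ℕ} [NeZero q] {g : Matrix (Fin n) (Fin m) (ZMod q) → ℝ}
    (hg : ∀ A, 0 ≤ g A) : 0 ≤ matrixAvg n m q g :=
  div_nonneg (Finset.sum_nonneg fun A _ => hg A) (by positivity)

/-- The uniform average of a function bounded by `1` is at most `1`. [folklore] -/
theorem matrixAvg_le_one {n m q : ℕ} [NeZero q] {g : Matrix (Fin n) (Fin m) (ZMod q) → ℝ}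
    (hg : ∀ A, g A ≤ 1) : matrixAvg n m q g ≤ 1 := by
  unfold matrixAvg
  have hq : (0 : ℝ) < (q : ℝ) ^ (n * m) := by
    have : 0 < q := Nat.pos_of_ne_zero (NeZero.ne q)
    positivity
  rw [div_le_one hq]
  calc ∑ A : Matrix (Fin n) (Fin m) (ZMod q), g A
      ≤ ∑ _A : Matrix (Fin n) (Fin m) (ZMod q), (1 : ℝ) := Finset.sum_le_sum fun A _ => hg A
    _ = (q : ℝ) ^ (n * m) := by
        rw [Finset.sum_const, Finset.card_univ, card_matrix, nsmul_eq_mul, mul_one]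
        push_cast; rfl

/-- The uniform average is monotone. [folklore] -/
theorem matrixAvg_mono {n m q : ℕ} [NeZero q] {g g' : Matrix (Fin n) (Fin m) (ZMod q) → ℝ}
    (h : ∀ A, g A ≤ g' A) : matrixAvg n m q g ≤ matrixAvg n m q g' :=
  div_le_div_of_nonneg_right (Finset.sum_le_sum fun A _ => h A) (by positivity)

/-- Bridge to Mathlib's expectation API: the uniform average is `Finset.expect` over all
matrices, `𝔼 A, g A = (∑ A, g A) / #ℤ_q^{n×m}`. [Mathlib `Finset.expect`] [folklore] -/
theorem matrixAvg_eq_expect {n m q : ℕ} [NeZero q] (g : Matrix (Fin n) (Fin m) (ZMod q) → ℝ) :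
    matrixAvg n m q g = Finset.univ.expect g := by
  rw [Finset.expect_eq_sum_div_card, Finset.card_univ, card_matrix, matrixAvg]
  push_cast
  rfl

/-- `SIS.successProb B n m q β`: the average-case success probability of the randomised
algorithm `B : {0,1}* → {0,1}*` (G01 `RandAlg`, identity input encoding) on the ensemble
`SIS_{q,m,β}` in dimension `n`: the probability, over a uniformly random `A ∈ ℤ_q^{n×m}` and the
coins of `B`, that the output of `B` on `encodeMatrix A`, read as an integer vector of
dimension `m` (`Literature.Lattice.decodeIntVec m`, junk `0` — never a solution — on malformed
words), is a solution of the SIS instance `(q, A, β)`. [Micciancio–Regev 2007, Def. 5.3 and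
proof of Thm. 5.9/5.23 ("an oracle solving SIS_{q,m,β} on the average with probability δ")] [cite: MicciancioRegev2007, Def. 5.3] -/
def successProb (B : RandAlg (List Bool) (List Bool)) (n m q : ℕ) [NeZero q] (β : ℝ) : ℝ :=
  matrixAvg n m q fun A => B.pr id (encodeMatrix A) {w | IsSolution A β (decodeIntVec m w)}

/-- `SIS.successProb' B n m q β`: the same for the variant SIS′ (output must have an odd
coordinate). [Micciancio–Regev 2007, Def. 5.4 (ensemble SIS′_{q,m,β}) and proof of Thm. 5.23] [cite: MicciancioRegev2007, Def. 5.4] -/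
def successProb' (B : RandAlg (List Bool) (List Bool)) (n m q : ℕ) [NeZero q] (β : ℝ) : ℝ :=
  matrixAvg n m q fun A => B.pr id (encodeMatrix A) {w | IsSolution' A β (decodeIntVec m w)}

/-- Success probabilities lie in `[0, 1]`: nonnegativity. [folklore] -/
theorem successProb_nonneg (B : RandAlg (List Bool) (List Bool)) (n m q : ℕ) [NeZero q]
    (β : ℝ) : 0 ≤ successProb B n m q β :=
  matrixAvg_nonneg fun _ => B.pr_nonneg _ _ _

/-- Success probabilities lie in `[0, 1]`: upper bound. [folklore] -/
theorem successProb_le_one (B : RandAlg (List Bool) (List Bool)) (n m q : ℕ) [NeZero q]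
    (β : ℝ) : successProb B n m q β ≤ 1 :=
  matrixAvg_le_one fun _ => B.pr_le_one _ _ _

/-- Success probabilities for SIS′ lie in `[0, 1]`: nonnegativity. [folklore] -/
theorem successProb'_nonneg (B : RandAlg (List Bool) (List Bool)) (n m q : ℕ) [NeZero q]
    (β : ℝ) : 0 ≤ successProb' B n m q β :=
  matrixAvg_nonneg fun _ => B.pr_nonneg _ _ _

/-- Success probabilities for SIS′ lie in `[0, 1]`: upper bound. [folklore] -/
theorem successProb'_le_one (B : RandAlg (List Bool) (List Bool)) (n m q : ℕ) [NeZero q]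
    (β : ℝ) : successProb' B n m q β ≤ 1 :=
  matrixAvg_le_one fun _ => B.pr_le_one _ _ _

/-- A `RandAlg` event probability is monotone in the event. Dot-notation extension of
`Literature.Computability.Complexity.RandAlg` (file `CplxCore/Randomized.lean`), companion of `RandAlg.pr_nonneg` /
`RandAlg.pr_le_one` of `OneWayFunctions.lean`. [Arora–Barak 2009, §7.1; Mathlib
`MeasureTheory.OuterMeasure.mono`] [folklore] -/
theorem _root_.Literature.Computability.Complexity.RandAlg.pr_mono {α β : Type} (A : RandAlg α β) (ea : α → List Bool)
    (x : α) {E F : Set β} (h : E ⊆ F) : A.pr ea x E ≤ A.pr ea x F := by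
  unfold RandAlg.pr
  refine ENNReal.toReal_mono ?_ ((A.outputPMF ea x).toOuterMeasure.mono h)
  refine ne_top_of_le_ne_top ENNReal.one_ne_top ?_
  calc (A.outputPMF ea x).toOuterMeasure F
      ≤ (A.outputPMF ea x).toOuterMeasure Set.univ :=
        (A.outputPMF ea x).toOuterMeasure.mono (Set.subset_univ _)
    _ = 1 := (PMF.toOuterMeasure_apply_eq_one_iff _ _).2 (Set.subset_univ _)

/-- Solving SIS′ on the average is at least as demanding as solving SIS: the SIS′ success
probability of any algorithm is at most its SIS success probability (every SIS′ solution is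
an SIS solution). [Micciancio–Regev 2007, §5.1 (remark after Def. 5.4: "any solution to
SIS′_{q,m,β} is also a solution to SIS_{q,m,β}")] [cite: MicciancioRegev2007, Def. 5.4] -/
theorem successProb'_le_successProb (B : RandAlg (List Bool) (List Bool)) (n m q : ℕ)
    [NeZero q] (β : ℝ) : successProb' B n m q β ≤ successProb B n m q β :=
  matrixAvg_mono fun _ => B.pr_mono _ _ fun _ hw => IsSolution'.isSolution hw

end SIS

/-! ### The Micciancio–Regev theorem (MR07 Thm. 5.23 with Lemma 5.22): the named fact -/

section PQC

open SIS

/-- The Micciancio–Regev approximation factor `γ(n) = 14 π √n β(n)` of Theorem 5.23.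
[Micciancio–Regev 2007, Thm. 5.23] [cite: MicciancioRegev2007, Thm. 5.23] -/
def mrGamma (β : ℕ → ℝ) (n : ℕ) : ℝ := 14 * Real.pi * Real.sqrt n * β n

/-- The Micciancio–Regev modulus condition of Theorem 5.23: `q(n) ≥ 4 √(m(n)) n^{1.5} β(n)`
for every `n` (`n^{1.5}` written `n √n`). [Micciancio–Regev 2007, Thm. 5.23] [cite: MicciancioRegev2007, Thm. 5.23] -/
def MRModulusCondition (q m : ℕ → ℕ) (β : ℕ → ℝ) : Prop :=
  ∀ n : ℕ, 4 * Real.sqrt (m n) * ((n : ℝ) * Real.sqrt n) * β n ≤ q n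

/-- The factor is at least `1` whenever `1 ≤ β n` and `1 ≤ n` (as `14 π √n ≥ 1`); note
`mrGamma β 0 = 0`, so consumers feeding hardness hypotheses quantified over factors `γ ≥ 1`
use `max 1 (mrGamma β ·)` (the restricted YES/NO sets agree from dimension `1` on).
[Micciancio–Regev 2007, Thm. 5.23] [cite: MicciancioRegev2007, Thm. 5.23] -/
theorem one_le_mrGamma {β : ℕ → ℝ} {n : ℕ} (hβ : 1 ≤ β n) (hn : 1 ≤ n) : 1 ≤ mrGamma β n := by
  unfold mrGamma
  have hpi : (1 : ℝ) ≤ 14 * Real.pi := by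
    have := Real.two_le_pi
    linarith
  have hsq : (1 : ℝ) ≤ Real.sqrt n := by
    rw [Real.one_le_sqrt]
    exact_mod_cast hn
  calc (1 : ℝ) = 1 * 1 * 1 := by ring
    _ ≤ 14 * Real.pi * Real.sqrt n * β n := by
        gcongr

/-- `mrGamma β` is polynomially bounded when `β` is (`14 π √n β(n) ≤ 56 (n+1) p(n)`, using `π ≤ 4`).
[Micciancio–Regev 2007, Thm. 5.23 (`γ = β · Õ(√n)`); Arora–Barak 2009, §1.6] [cite: MicciancioRegev2007, Thm. 5.23] -/
theorem isPolyBoundedReal_mrGamma {β : ℕ → ℝ} (hβ : IsPolyBoundedReal β) (hβ0 : ∀ n, 0 ≤ β n) :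
    IsPolyBoundedReal (mrGamma β) := by
  obtain ⟨p, hp⟩ := hβ
  refine ⟨Polynomial.C 56 * (Polynomial.X + 1) * p, fun n => ?_⟩
  have hsqrt : Real.sqrt n ≤ (n : ℝ) + 1 := by
    rw [Real.sqrt_le_left (by positivity)]
    nlinarith [(Nat.cast_nonneg n : (0 : ℝ) ≤ n)]
  have hpi : 14 * Real.pi ≤ (56 : ℝ) := by
    have := Real.pi_le_four
    linarith
  simp only [Polynomial.eval_mul, Polynomial.eval_C, Polynomial.eval_add, Polynomial.eval_X,
    Polynomial.eval_one, Nat.cast_mul, Nat.cast_add, Nat.cast_one, Nat.cast_ofNat, mrGamma]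
  calc 14 * Real.pi * Real.sqrt n * β n ≤ 56 * ((n : ℝ) + 1) * β n := by
        apply mul_le_mul_of_nonneg_right _ (hβ0 n)
        calc 14 * Real.pi * Real.sqrt n ≤ 56 * Real.sqrt n :=
              mul_le_mul_of_nonneg_right hpi (Real.sqrt_nonneg _)
          _ ≤ 56 * ((n : ℝ) + 1) := by gcongr
    _ ≤ 56 * ((n : ℝ) + 1) * ((p.eval n : ℕ) : ℝ) := by
        gcongr
        exact hp n

/-- NAMED FACT (**Micciancio–Regev 2007, Thm. 5.23 with Lemma 5.22**, GapSVP → SIS′; nothing is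
asserted, users take `(h : MicciancioRegev2007_gapSVP_to_SIS')`).
Printed statement (authors' full version, p. 28): for any polynomially bounded functions
`β(n), m(n), q(n) = n^{O(1)}` with `q(n) ≥ 4 √(m(n)) n^{1.5} β(n)` and `γ(n) = 14 π √n β(n)`,
there is a probabilistic polynomial-time reduction from solving GapCVP′_γ in the worst case
to solving SIS′_{q,m,β} on the average with non-negligible probability; and (p. 27, by the
dimension-preserving deterministic reduction GapSVP_γ → GapCVP′_γ of Lemma 5.22) hence from
GapSVP_γ. The reduction on `n`-dimensional instances queries the SIS′ oracle only on uniformly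
random `A ∈ ℤ_{q(n)}^{n×m(n)}` of the same `n` (proof, p. 28), so it works dimension-wise.
Lean rendering ("reduction + PPT oracle ⇒ promise-BPP", dimension-wise): for parameters as
above (`β > 0` given by a polynomial-time computable rational sequence and `q, m`
polynomial-time computable from `1ⁿ` — the implicit uniformity hypothesis
`IsPolyTimeParams q β m`, cf. `LWEHardness.lean`), for every PPT algorithm `B` (G01 `RandAlg`,
`IsPPT B id`), every exponent `c` and every set `S` of dimensions: if `B` solves
SIS′_{q(n),m(n),β(n)} on the average with probability `≥ 1/n^c` for every `n ∈ S`, then for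
some `n₀` the promise problem GapSVP_γ restricted to instances of dimension `n ∈ S`, `n ≥ n₀`
(codes under `gapSVPInstanceEncoding`) lies in textbook promise-BPP (`CplxCore.PromiseBPP'`).
[cite: MicciancioRegev2007, Thm. 5.23 (with Lemma 5.22; full version p. 27–28)] -/
def MicciancioRegev2007_gapSVP_to_SIS' : Prop :=
  ∀ (q m : ℕ → ℕ) [∀ n, NeZero (q n)] (β : ℕ → ℝ),
    IsPolyBounded q → IsPolyBounded m → IsPolyBoundedReal β → IsPolyTimeParams q β m →
    (∀ n, 0 < β n) → MRModulusCondition q m β →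
    ∀ B : RandAlg (List Bool) (List Bool), IsPPT B id → ∀ (c : ℕ) (S : Set ℕ),
      (∀ n ∈ S, 1 / (n : ℝ) ^ c ≤ successProb' B n (m n) (q n) (β n)) →
      ∃ n₀ : ℕ, PromiseProblem.ofEncoding gapSVPInstanceEncoding
          {p | p ∈ GapSVP.yes (mrGamma β) ∧ p.1.n ∈ S ∩ Set.Ici n₀}
          {p | p ∈ GapSVP.no (mrGamma β) ∧ p.1.n ∈ S ∩ Set.Ici n₀} ∈ PromiseBPP'

/-- Restricting the dimension set further keeps the conclusion of the Micciancio–Regev facts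
usable against hardness hypotheses quantified over infinite sets of dimensions: the
restricted YES/NO sets for `S ∩ Ici n₀` are those for the set `S' := S ∩ Ici n₀` itself, and
`S'` is infinite when `S` is. [folklore] -/
theorem infinite_inter_Ici {S : Set ℕ} (hS : S.Infinite) (n₀ : ℕ) : (S ∩ Set.Ici n₀).Infinite := by
  have : S ∩ Set.Ici n₀ = S \ Set.Iio n₀ := by
    ext n; simp [not_lt]
  rw [this]
  exact hS.sdiff (Set.finite_Iio n₀)

end PQC

end Literature.Computability.Cryptography

end
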